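import Summits.QuantumAdvantage.AdviceFreeQNC0.AffBells21Characters
import Summits.QuantumAdvantage.AdviceFreeQNC0.AffBells21Descent
import HarnessLib

/-!
# Cell qa-qnc0, plan S2 engine: the MASKED termwise Fourier bound — (PHI) for systems with dead rows

Support for crux `RingDenseResidualLt3` (stmt-QuantumAdvantage-22907), route `DWalkThree`; planner qa-qnc0-p1 g21
ROUND-20 §2.8 ("(PHI) is applied to the COMPRESSED child (dead rows removed), never to `childB` verbatim").
The children of the descent (`AffBells21.childB`) keep the row index type and turn non-survivors into ZERO rows with a
non-zero residue.  Such DEAD rows are never hit, so they can be masked out of the character expansion of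
[ChattopadhyayWigderson2009] Lemma 5: only dual vectors `ξ` supported on the live set `S` survive, and the potential
is `Σ_{supp ξ ⊆ S} 3^{−|S|} 2^{wt ξ} 2^{−wt(ξB)}` (the compressed `Φ`, without the `5/3`-per-dead-row inflation).

PROVED here (0 sorry):
* `maskCoef` / `sign_row_eq_sum_maskCoef` — one row as characters, live (`c_0 = 1/3`, `c_{±1} = −2/3`) or dead (`δ_{t,0}`);
* `norm_prod_maskCoef_le` — `‖Π_k c_{k,ξ_k}‖ ≤ [supp ξ ⊆ S]·3^{−|S|}·2^{wt ξ}`;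
* **`abs_bias_le_masked`** — `|bias(B, r, 0)| ≤ Σ_{ξ : supp ξ ⊆ S} 3^{−|S|} 2^{wt ξ} 2^{−wt(ξB)}` whenever every row
  outside `S` is zero with residue `≠ 0`.

WHAT THIS IS NOT: no statement about the crux; consumed by the generic-systems rung (`AffBells21Generic*`).
-/

namespace Summit.QuantumAdvantage.AdviceFreeQNC0

open Finset
open Literature.Computability.MetaComplexity

namespace AffBells21

variable {q s : ℕ}

/-- The character coefficients of one row: live rows carry `c_t = [t = 0] − 2/3`, dead rows `δ_{t,0}`. -/
noncomputable def maskCoef (S : Finset (Fin s)) (k : Fin s) (t : ZMod 3) : ℂ :=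
  if k ∈ S then ((if t = 0 then (1 : ℂ) else 0) - 2 * (3 : ℂ)⁻¹) else (if t = 0 then (1 : ℂ) else 0)

/-- One row as characters: the sign `(−1)^{[⟨B_k,F⟩ ≡ r_k]}` equals `Σ_t c_{k,t} ω^{t(⟨B_k,F⟩ − r_k)}` for a live row,
and a dead row (`B_k = 0`, `r_k ≠ 0`, never hit) equals `Σ_t δ_{t,0} ω^{t(…)} = 1`. -/
theorem sign_row_eq_sum_maskCoef (B : Fin s → Fin q → ZMod 3) (r : Fin s → ZMod 3) (S : Finset (Fin s))
    (hB : ∀ k, k ∉ S → B k = 0) (hr : ∀ k, k ∉ S → r k ≠ 0) (F : Fin q → Bool) (k : Fin s) :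
    (if rowSum B k F = r k then (-1 : ℂ) else 1)
      = ∑ t : ZMod 3, maskCoef S k t * (ZMod.stdAddChar (t * (rowSum B k F - r k)) : ℂ) := by
  unfold maskCoef
  by_cases hkS : k ∈ S
  · simp only [hkS, if_true]
    have hcond : (rowSum B k F = r k) ↔ (rowSum B k F - r k = 0) := sub_eq_zero.symm
    simp only [hcond]
    rw [TwoModuli.sign_ite_eq_sum_stdAddChar (rowSum B k F - r k)]
    norm_num
  · simp only [hkS, if_false]
    have hrow : rowSum B k F = 0 := by
      unfold rowSum
      exact sum_eq_zero fun j _ => by rw [hB k hkS]; simp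
    have hne : ¬ (rowSum B k F = r k) := by
      rw [hrow]
      exact fun h => hr k hkS h.symm
    rw [if_neg hne]
    simp only [ite_mul, one_mul, zero_mul]
    rw [Finset.sum_ite_eq' univ (0 : ZMod 3)]
    simp

/-- The coefficient product vanishes off `supp ξ ⊆ S` and has modulus `3^{−|S|} 2^{wt ξ}` on it. -/
theorem norm_prod_maskCoef_le (S : Finset (Fin s)) (ξ : Fin s → ZMod 3) :
    ‖∏ k : Fin s, maskCoef S k (ξ k)‖
      ≤ if (∀ k, k ∉ S → ξ k = 0) then
          (3 : ℝ)⁻¹ ^ S.card * (2 : ℝ) ^ (univ.filter fun k : Fin s => ξ k ≠ 0).card else 0 := by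
  by_cases hsupp : ∀ k, k ∉ S → ξ k = 0
  · rw [if_pos hsupp, norm_prod]
    -- per-row weights
    have hk : ∀ k : Fin s, ‖maskCoef S k (ξ k)‖
        ≤ (if k ∈ S then (3 : ℝ)⁻¹ else 1) * (if ξ k ≠ 0 then 2 else 1) := by
      intro k
      unfold maskCoef
      by_cases hkS : k ∈ S
      · simp only [hkS, if_true]
        by_cases h0 : ξ k = 0
        · simp only [h0, if_true, ne_eq, not_true_eq_false, if_false]
          norm_num
        · simp only [h0, if_false, ne_eq, not_false_eq_true, if_true]
          norm_num
      · have h0 : ξ k = 0 := hsupp k hkS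
        simp [hkS, h0]
    calc ∏ k : Fin s, ‖maskCoef S k (ξ k)‖
        ≤ ∏ k : Fin s, ((if k ∈ S then (3 : ℝ)⁻¹ else 1) * (if ξ k ≠ 0 then 2 else 1)) :=
          prod_le_prod (fun k _ => norm_nonneg _) fun k _ => hk k
      _ = (3 : ℝ)⁻¹ ^ S.card * (2 : ℝ) ^ (univ.filter fun k : Fin s => ξ k ≠ 0).card := by
          rw [prod_mul_distrib, prod_ite, prod_const_one, mul_one, prod_const, prod_ite, prod_const_one, mul_one,
            prod_const, Finset.filter_univ_mem]
  · rw [if_neg hsupp]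
    push Not at hsupp
    obtain ⟨k₀, hk₀S, hk₀⟩ := hsupp
    have hzero : ∏ k : Fin s, maskCoef S k (ξ k) = 0 := by
      apply prod_eq_zero (mem_univ k₀)
      unfold maskCoef
      rw [if_neg hk₀S, if_neg hk₀]
    rw [hzero, norm_zero]

/-- Expansion of the sign of one coin vector: `(−1)^{#hit(F)} = Σ_ξ (Π_k c_{k,ξ_k}) ω^{−⟨ξ,r⟩} ω^{⟨ξB, F⟩}`. -/
theorem neg_one_pow_hit_eq_sum_mask (B : Fin s → Fin q → ZMod 3) (r : Fin s → ZMod 3) (S : Finset (Fin s))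
    (hB : ∀ k, k ∉ S → B k = 0) (hr : ∀ k, k ∉ S → r k ≠ 0) (F : Fin q → Bool) :
    (-1 : ℂ) ^ (univ.filter fun k : Fin s => rowSum B k F = r k).card
      = ∑ ξ : Fin s → ZMod 3, (∏ k : Fin s, maskCoef S k (ξ k))
          * ((ZMod.stdAddChar (-(∑ k : Fin s, ξ k * r k)) : ℂ)
            * (ZMod.stdAddChar (∑ j : Fin q, if F j then (∑ k : Fin s, ξ k * B k j) else 0) : ℂ)) := by
  rw [TwoModuli.neg_one_pow_card_filter_eq_prod]
  simp_rw [sign_row_eq_sum_maskCoef B r S hB hr F]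
  rw [Fintype.prod_sum]
  refine sum_congr rfl fun ξ _ => ?_
  rw [prod_mul_distrib, ← stdAddChar_sum_eq_prod, ← AddChar.map_add_eq_mul]
  congr 2
  unfold rowSum
  rw [← TwoModuli.sum_mul_subsetSum_eq B ξ F]
  simp only [mul_sub, sum_sub_distrib]
  ring

/-- **Masked (PHI)**: if every row outside `S` is dead (zero row, residue `≠ 0`), then
`|bias(B, r, 0)| ≤ Σ_{ξ : supp ξ ⊆ S} 3^{−|S|} · 2^{wt ξ} · 2^{−wt(ξB)}`. -/
theorem abs_bias_le_masked (B : Fin s → Fin q → ZMod 3) (r : Fin s → ZMod 3) (S : Finset (Fin s))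
    (hB : ∀ k, k ∉ S → B k = 0) (hr : ∀ k, k ∉ S → r k ≠ 0) :
    |bias q s B r (fun _ => false)|
      ≤ ∑ ξ ∈ (univ : Finset (Fin s → ZMod 3)).filter (fun ξ => ∀ k, k ∉ S → ξ k = 0),
          (3 : ℝ)⁻¹ ^ S.card * (2 : ℝ) ^ (univ.filter fun k : Fin s => ξ k ≠ 0).card
            * (2 : ℝ)⁻¹ ^ (univ.filter fun j : Fin q => (∑ k : Fin s, ξ k * B k j) ≠ 0).card := by
  -- remove the (empty) `λ`-term
  have hempty : ∀ F : Fin q → Bool,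
      (univ.filter fun j : Fin q => (fun _ : Fin q => false) j = true ∧ F j = true).card = 0 := by
    intro F
    rw [Finset.card_eq_zero, Finset.filter_eq_empty_iff]
    intro j _ h
    exact Bool.false_ne_true h.1
  set T : ℝ := ∑ F : Fin q → Bool, (-1 : ℝ) ^ (univ.filter fun k : Fin s => rowSum B k F = r k).card with hT
  have hbias : bias q s B r (fun _ => false) = T / (2 : ℝ) ^ q := by
    rw [bias_eq_sum_rowSum, hT]
    congr 1
    exact sum_congr rfl fun F _ => by rw [hempty F, add_zero]
  -- complexify and expand
  have hTC : (T : ℂ) = ∑ ξ : Fin s → ZMod 3, (∏ k : Fin s, maskCoef S k (ξ k))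
      * ((ZMod.stdAddChar (-(∑ k : Fin s, ξ k * r k)) : ℂ)
        * ∑ F : Fin q → Bool,
            (ZMod.stdAddChar (∑ j : Fin q, if F j then (∑ k : Fin s, ξ k * B k j) else 0) : ℂ)) := by
    rw [hT, Complex.ofReal_sum]
    simp_rw [Complex.ofReal_pow, Complex.ofReal_neg, Complex.ofReal_one, neg_one_pow_hit_eq_sum_mask B r S hB hr]
    rw [sum_comm]
    refine sum_congr rfl fun ξ _ => ?_
    rw [mul_sum, mul_sum]
  -- termwise norm bound
  have hcos : Real.cos (Real.pi / ((3 : ℕ) : ℝ)) = (2 : ℝ)⁻¹ := by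
    rw [Nat.cast_ofNat, Real.cos_pi_div_three]
    norm_num
  have hterm : ∀ ξ : Fin s → ZMod 3,
      ‖(∏ k : Fin s, maskCoef S k (ξ k))
        * ((ZMod.stdAddChar (-(∑ k : Fin s, ξ k * r k)) : ℂ)
          * ∑ F : Fin q → Bool,
              (ZMod.stdAddChar (∑ j : Fin q, if F j then (∑ k : Fin s, ξ k * B k j) else 0) : ℂ))‖
        ≤ (if (∀ k, k ∉ S → ξ k = 0) then
            (3 : ℝ)⁻¹ ^ S.card * (2 : ℝ) ^ (univ.filter fun k : Fin s => ξ k ≠ 0).card else 0)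
          * ((2 : ℝ) ^ q * (2 : ℝ)⁻¹ ^ (univ.filter fun j : Fin q => (∑ k : Fin s, ξ k * B k j) ≠ 0).card) := by
    intro ξ
    rw [norm_mul, norm_mul, norm_stdAddChar_three, one_mul]
    refine mul_le_mul (norm_prod_maskCoef_le S ξ) ?_ (norm_nonneg _) (by positivity)
    have h := TwoModuli.norm_sum_stdAddChar_subsetSum_le (N := 3) (fun j : Fin q => ∑ k : Fin s, ξ k * B k j)
    rw [hcos, Fintype.card_fin] at h
    exact h
  -- assemble
  have hTabs : |T| ≤ (2 : ℝ) ^ q * ∑ ξ ∈ (univ : Finset (Fin s → ZMod 3)).filter (fun ξ => ∀ k, k ∉ S → ξ k = 0),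
      (3 : ℝ)⁻¹ ^ S.card * (2 : ℝ) ^ (univ.filter fun k : Fin s => ξ k ≠ 0).card
        * (2 : ℝ)⁻¹ ^ (univ.filter fun j : Fin q => (∑ k : Fin s, ξ k * B k j) ≠ 0).card := by
    rw [← Real.norm_eq_abs, ← Complex.norm_real, hTC]
    refine (norm_sum_le _ _).trans ((sum_le_sum fun ξ _ => hterm ξ).trans (le_of_eq ?_))
    rw [sum_filter, mul_sum]
    refine sum_congr rfl fun ξ _ => ?_
    split_ifs <;> ring
  rw [hbias, abs_div, abs_of_pos (by positivity : (0 : ℝ) < 2 ^ q), div_le_iff₀ (by positivity)]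
  calc |T| ≤ _ := hTabs
    _ = _ := by rw [mul_comm]

end AffBells21

end Summit.QuantumAdvantage.AdviceFreeQNC0
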